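import Summits.BirchSwinnertonDyer.Rank1Residual.Additive.DeuringThree
import Literature.NumberTheory.EllipticCurves.GlobalMinimalModel
import HarnessLib

/-!
# The anomalous bit over `𝔽₃` is the residue of `b₂`: `#Ẽ(𝔽₃) ≡ 1 − b₂ (mod 3)`, so
# `3 ∣ #Ẽ(𝔽₃) ⟺ b₂(Ẽ) = 1` and `a₃ ≡ b₂ (mod 3)` for every curve good at `3`

HONEST FRAMING (cell `b2b-bsdres`, run/shared/lean/b2b/bsd-rank1-residual/, verbatim in every
file): the goal of the cell is to DELETE the COMBINATION-SHAPED residual classes of the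
Birch–Swinnerton-Dyer formula for ALL analytic-rank `≤ 1` elliptic curves over `ℚ` — "full BSD
formula for every rank `≤ 1` curve in class `C`" assembled STRICTLY from published theorems — so
that the rank-`≤ 1` remainder becomes exactly the CONSTRUCTION-SHAPED classes, which are TYPED
(missing-input `Prop`s), NOT attempted. This is not "finishing BSD". Sub-cell `additive-p2`
(X3♯(G-ord) / X4♯(G-ord)), generation 39: research route; no claim beyond the stated classes;
TOOL theorems on curves over `𝔽₃` / `ℤ` only, no definition, no named fact, nothing booked.

## What and why

Generation 10 (`Additive/DeuringThree`) proved that over a finite field of characteristic `3` the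
trace of `y² = x³ + a₂x² + a₄x + a₆` is congruent to the HASSE INVARIANT `a₂^{(q−1)/2}`, and drew
the supersingular criterion `3 ∣ q + 1 − #E ⟺ a₂ = 0 ⟺ j = 0`.  This file draws the OTHER
consequence at `q = 3`, the one the torsion question of the sub-cell needs (generation 38, item
(θ): "`3`-torsion on a (G)-pair at `3` ⟹ anomalous over `ℚ(√−3)`"):

* `intCast_trace_eq_a₂_pow_of_isCharNeTwoNF` — `(q + 1 − #E(F) : F) = a₂^{(q−1)/2}` in every
  finite field `F` of characteristic `3` (the congruence "trace ≡ Hasse invariant", now as an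
  equation rather than only its vanishing locus);
* **`three_dvd_natCard_point_iff_a₂_eq_one`** (`#F = 3`, `a₁ = a₃ = 0` form) and
  **`three_dvd_natCard_point_iff_b₂_eq_one`** (`#F = 3`, ANY Weierstrass equation):
  `3 ∣ #E(F) ⟺ b₂(E) = 1` — over `𝔽₃` the ANOMALOUS bit (`3 ∣ #Ẽ(𝔽₃)`, i.e. `a₃ ≡ 1`) is the
  residue `b₂ = 1`, just as the supersingular bit is `b₂ = 0` (`#E(𝔽₃) ≡ 1 − b₂ (mod 3)`,
  `intCast_natCard_point_eq_one_sub_b₂`);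
* integer-model forms **`three_dvd_natCard_point_map_iff_dvd_b₂_sub_one`** (`E₀/ℤ`, `3 ∤ Δ(E₀)`:
  `3 ∣ #(E₀ mod 3)(𝔽₃) ⟺ 3 ∣ b₂(E₀) − 1`) and, for a globally minimal `V/ℚ` good at `3`,
  **`three_dvd_reductionPointCount_iff_dvd_b₂_sub_one`** /
  **`three_dvd_frobeniusTrace_sub_one_iff_dvd_b₂_sub_one`**: `a₃(V) ≡ 1 (mod 3) ⟺ b₂(V_ℤ) ≡ 1 (mod 3)`
  — the tree's `frobeniusTrace` / `reductionPointCount` read on Mathlib's `b₂` of the minimal model.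

These feed `Additive/GordTorsionAnomalousThree` (a `3`-torsion point on `E = V^{(−3)}` forces
`b₂(V) ≡ 1 (mod 3)`, `Additive/LocalTorsionAnomalousThree`), closing the `p = 3` twin of
generation 38's "the torsion exception is anomalous".

References: M. Deuring, Abh. Math. Sem. Hamburg 14 (1941) §§4–5; J. H. Silverman, *AEC* V.4.1(a),
Ex. 5.7 (`#E(𝔽_q) ≡ 1 − A_q`); L. C. Washington, *Elliptic Curves* §4.6 (Thm. 4.34);
D. Husemöller, *Elliptic Curves* Ch. 13 Prop. 3.6 (Hasse invariant `a₂` in characteristic `3`);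
B. Mazur, Invent. Math. 18 (1972) §1 (anomalous primes: `a_p ≡ 1 (mod p)`).
-/

noncomputable section

open scoped Classical

open Finset Polynomial WeierstrassCurve

namespace Summit.BirchSwinnertonDyer.Rank1Residual.Additive

namespace DeuringThree

/-! ### The trace IS the Hasse invariant in `F` (characteristic `3`, `a₁ = a₃ = 0` form) -/

section CharNeTwoNF

variable {F : Type*} [Field F] [Fintype F] (E : WeierstrassCurve F) [E.IsCharNeTwoNF]
  [E.IsElliptic]

/-- **Trace ≡ Hasse invariant, as an equation in `F`**: for `E : y² = x³ + a₂x² + a₄x + a₆`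
elliptic over a finite field `F` of characteristic `3` (`#F = q = 3^f`),
`(q + 1 − #E(F) : F) = a₂^{(q−1)/2}` (`= a₂^{⌊q/2⌋}`): Euler's criterion form of the trace
(`intCast_trace_eq_neg_sum_pow_of_isCharNeTwoNF`), the power-sum evaluation
`Σ_x P(x) = −[x^{q−1}]P` (`sum_eval_eq_neg_coeff`) and the Hasse-invariant coefficient
`[x^{q−1}](x³ + a₂x² + a₄x + a₆)^{(q−1)/2} = a₂^{(q−1)/2}` (`coeff_cubic_pow_eq`). Silverman *AEC*
V.4.1(a) (proof), Ex. 5.7; Washington Thm. 4.34; Husemöller Ch. 13 Prop. 3.6. -/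
theorem intCast_trace_eq_a₂_pow_of_isCharNeTwoNF (hchar : ringChar F = 3) :
    (((Fintype.card F : ℤ) + 1 - Nat.card E.toAffine.Point : ℤ) : F) =
      E.a₂ ^ (Fintype.card F / 2) := by
  haveI : CharP F 3 := ringChar.of_eq hchar
  have hF : ringChar F ≠ 2 := by rw [hchar]; decide
  obtain ⟨n, -, hn⟩ := FiniteField.card F 3
  have hq : Fintype.card F = 2 * (Fintype.card F / 2) + 1 :=
    Literature.NumberTheory.EllipticCurves.HasseElementary.card_eq_two_mul_add_one hF
  have hq1 : 1 < Fintype.card F := Fintype.one_lt_card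
  rw [intCast_trace_eq_neg_sum_pow_of_isCharNeTwoNF E hF]
  set P : F[X] := X ^ 3 + C E.a₂ * X ^ 2 + C E.a₄ * X + C E.a₆ with hP
  have heval : ∀ x : F, (x ^ 3 + E.a₂ * x ^ 2 + E.a₄ * x + E.a₆) ^ (Fintype.card F / 2) =
      (P ^ (Fintype.card F / 2)).eval x := by
    intro x
    simp [hP, eval_pow]
  simp_rw [heval]
  have hP3 : P.natDegree ≤ 3 := by
    simpa [hP] using Polynomial.natDegree_cubic_le (a := (1 : F)) (b := E.a₂) (c := E.a₄) (d := E.a₆)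
  have hdeg : (P ^ (Fintype.card F / 2)).natDegree < 2 * (Fintype.card F - 1) := by
    refine lt_of_le_of_lt natDegree_pow_le ?_
    have := Nat.mul_le_mul_left (Fintype.card F / 2) hP3
    omega
  rw [sum_eval_eq_neg_coeff _ hdeg, neg_neg, hn,
    show 3 ^ (n : ℕ) / 2 = (3 ^ (n : ℕ) - 1) / 2 by omega, hP, coeff_cubic_pow_eq]

/-- **Over `𝔽₃` (`#F = 3`), `a₁ = a₃ = 0` form: `(4 − #E(F) : F) = a₂`** — the trace of an elliptic
curve over the field with three elements is, in `𝔽₃`, the coefficient `a₂` (its Hasse invariant).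
Silverman *AEC* V.4.1(a); Husemöller Ch. 13 Prop. 3.6. -/
theorem intCast_trace_eq_a₂_of_card_eq_three (hcard : Fintype.card F = 3) :
    (((4 : ℤ) - Nat.card E.toAffine.Point : ℤ) : F) = E.a₂ := by
  haveI : Fact (Nat.Prime 3) := ⟨Nat.prime_three⟩
  haveI : CharP F 3 := charP_of_card_eq_prime hcard
  have hchar : ringChar F = 3 := ringChar.eq F 3
  have h := intCast_trace_eq_a₂_pow_of_isCharNeTwoNF E hchar
  rw [hcard] at h
  norm_num at h
  rw [← h]
  push_cast
  ring

/-- **Over `𝔽₃`, `a₁ = a₃ = 0` form: `3 ∣ #E(F) ⟺ a₂ = 1`** (`#E(F) ≡ 4 − a₂ ≡ 1 − a₂ (mod 3)`):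
the ANOMALOUS bit over the field with three elements is the residue `a₂ = 1`, as the supersingular
bit is `a₂ = 0` (`three_dvd_trace_iff_a₂_eq_zero`). Silverman *AEC* V.4.1(a), Ex. 5.7;
Mazur 1972 §1 (anomalous: `a_p ≡ 1 (mod p)`). -/
theorem three_dvd_natCard_point_iff_a₂_eq_one (hcard : Fintype.card F = 3) :
    3 ∣ Nat.card E.toAffine.Point ↔ E.a₂ = 1 := by
  haveI : Fact (Nat.Prime 3) := ⟨Nat.prime_three⟩
  haveI : CharP F 3 := charP_of_card_eq_prime hcard
  have h := intCast_trace_eq_a₂_of_card_eq_three E hcard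
  have h3 : (3 : F) = 0 := by simpa using CharP.cast_eq_zero F 3
  have h4 : (4 : F) = 1 := by rw [show (4 : F) = 3 + 1 by norm_num, h3, zero_add]
  have h' : (1 : F) - (Nat.card E.toAffine.Point : F) = E.a₂ := by
    push_cast at h
    rwa [h4] at h
  rw [← CharP.cast_eq_zero_iff F 3 (Nat.card E.toAffine.Point)]
  constructor
  · intro h0
    rw [h0, sub_zero] at h'
    exact h'.symm
  · intro h1
    rw [h1] at h'
    exact sub_eq_self.mp h'

end CharNeTwoNF

/-! ### Over `𝔽₃`, any Weierstrass equation: the anomalous bit is `b₂ = 1` -/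

section General

variable {F : Type*} [Field F] [Fintype F] (E : WeierstrassCurve F) [E.IsElliptic]

/-- **Over `𝔽₃` (`#F = 3`), ANY Weierstrass equation: `(4 − #E(F) : F) = b₂`** — the trace in `𝔽₃`
is `b₂ = a₁² + 4a₂` (complete the square: `toCharNeTwoNF` has `u = 1`, `r = 0`, so it preserves
`b₂` and the point count, and in `a₁ = a₃ = 0` form `b₂ = 4a₂ = a₂` in characteristic `3`).
Silverman *AEC* V.4.1(a), III.1; Husemöller Ch. 13 Prop. 3.6. -/
theorem intCast_trace_eq_b₂_of_card_eq_three (hcard : Fintype.card F = 3) :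
    (((4 : ℤ) - Nat.card E.toAffine.Point : ℤ) : F) = E.b₂ := by
  haveI : Fact (Nat.Prime 3) := ⟨Nat.prime_three⟩
  haveI : CharP F 3 := charP_of_card_eq_prime hcard
  have hchar : ringChar F = 3 := ringChar.eq F 3
  have h2 : (2 : F) ≠ 0 := Ring.two_ne_zero (by rw [hchar]; decide)
  haveI : Invertible (2 : F) := invertibleOfNonzero h2
  have h3 : (3 : F) = 0 := by simpa using CharP.cast_eq_zero F 3
  have h4 : (4 : F) = 1 := by rw [show (4 : F) = 3 + 1 by norm_num, h3, zero_add]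
  have hb : (E.toCharNeTwoNF • E).b₂ = E.b₂ := by
    rw [variableChange_b₂]
    simp [toCharNeTwoNF]
  rw [Nat.card_congr (VariableChange.pointEquiv E E.toCharNeTwoNF).toEquiv,
    intCast_trace_eq_a₂_of_card_eq_three (E.toCharNeTwoNF • E) hcard, ← hb, b₂_of_isCharNeTwoNF,
    h4, one_mul]

/-- **Over `𝔽₃`: `#E(F) ≡ 1 − b₂`**, i.e. `(#E(F) : F) = 1 − b₂(E)`. Silverman *AEC* Ex. 5.7
(`#E(𝔽_q) ≡ 1 − A_q`). -/
theorem natCast_natCard_point_eq_one_sub_b₂ (hcard : Fintype.card F = 3) :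
    ((Nat.card E.toAffine.Point : ℕ) : F) = 1 - E.b₂ := by
  haveI : Fact (Nat.Prime 3) := ⟨Nat.prime_three⟩
  haveI : CharP F 3 := charP_of_card_eq_prime hcard
  have h := intCast_trace_eq_b₂_of_card_eq_three E hcard
  have h3 : (3 : F) = 0 := by simpa using CharP.cast_eq_zero F 3
  have h4 : (4 : F) = 1 := by rw [show (4 : F) = 3 + 1 by norm_num, h3, zero_add]
  push_cast at h
  rw [h4] at h
  linear_combination (-1 : F) * h

/-- **Over `𝔽₃`, ANY Weierstrass equation of an elliptic curve: `3 ∣ #E(F) ⟺ b₂(E) = 1`** — the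
ANOMALOUS bit (`a₃ ≡ 1 (mod 3)`) is the residue `b₂ = 1` (and the supersingular bit is `b₂ = 0`,
`DeuringThree`). Silverman *AEC* V.4.1(a), Ex. 5.7; Mazur 1972 §1. -/
theorem three_dvd_natCard_point_iff_b₂_eq_one (hcard : Fintype.card F = 3) :
    3 ∣ Nat.card E.toAffine.Point ↔ E.b₂ = 1 := by
  haveI : Fact (Nat.Prime 3) := ⟨Nat.prime_three⟩
  haveI : CharP F 3 := charP_of_card_eq_prime hcard
  have h := natCast_natCard_point_eq_one_sub_b₂ E hcard
  rw [← CharP.cast_eq_zero_iff F 3 (Nat.card E.toAffine.Point), h, sub_eq_zero, eq_comm]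

end General

/-! ### Integer models and globally minimal curves over `ℚ`: `a₃ ≡ b₂ (mod 3)` -/

section IntModel

/-- The reduction modulo `3` of an integer Weierstrass model with `3 ∤ Δ` is an elliptic curve over
`𝔽₃`. [folklore] -/
theorem isElliptic_map_zmod_three_of_not_dvd (E₀ : WeierstrassCurve ℤ) (hΔ : ¬ (3 : ℤ) ∣ E₀.Δ) :
    (E₀.map (Int.castRingHom (ZMod 3))).IsElliptic := by
  refine ⟨isUnit_iff_ne_zero.mpr ?_⟩
  rw [map_Δ, eq_intCast, Ne, ZMod.intCast_zmod_eq_zero_iff_dvd]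
  exact_mod_cast hΔ

/-- **Integer model, `3 ∤ Δ(E₀)`: `3 ∣ #(E₀ mod 3)(𝔽₃) ⟺ 3 ∣ b₂(E₀) − 1`** — the anomalous bit at
`3` of a curve with good reduction is the residue of Mathlib's `b₂ = a₁² + 4a₂` of the model.
Silverman *AEC* V.4.1(a), Ex. 5.7; Mazur 1972 §1. -/
theorem three_dvd_natCard_point_map_iff_dvd_b₂_sub_one (E₀ : WeierstrassCurve ℤ)
    (hΔ : ¬ (3 : ℤ) ∣ E₀.Δ) :
    3 ∣ Nat.card (E₀.map (Int.castRingHom (ZMod 3))).toAffine.Point ↔ (3 : ℤ) ∣ E₀.b₂ - 1 := by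
  haveI := isElliptic_map_zmod_three_of_not_dvd E₀ hΔ
  rw [three_dvd_natCard_point_iff_b₂_eq_one _ (ZMod.card 3), map_b₂, eq_intCast, ← sub_eq_zero,
    ← Int.cast_one, ← Int.cast_sub, ZMod.intCast_zmod_eq_zero_iff_dvd]
  push_cast
  exact Iff.rfl

/-- **Integer model, `3 ∤ Δ(E₀)`: `(4 − #(E₀ mod 3)(𝔽₃)) ≡ b₂(E₀) (mod 3)`** — "`a₃ ≡ b₂ (mod 3)`":
the trace of Frobenius at `3` is congruent to the Hasse invariant `b₂`. Silverman *AEC* V.4.1(a);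
Husemöller Ch. 13 Prop. 3.6. -/
theorem intCast_trace_map_zmod_three_eq_b₂ (E₀ : WeierstrassCurve ℤ) (hΔ : ¬ (3 : ℤ) ∣ E₀.Δ) :
    (((4 : ℤ) - Nat.card (E₀.map (Int.castRingHom (ZMod 3))).toAffine.Point : ℤ) : ZMod 3) =
      (E₀.b₂ : ZMod 3) := by
  haveI := isElliptic_map_zmod_three_of_not_dvd E₀ hΔ
  rw [intCast_trace_eq_b₂_of_card_eq_three _ (ZMod.card 3), map_b₂, eq_intCast]

variable (V : WeierstrassCurve ℚ) [V.IsGloballyMinimal]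

/-- **`V/ℚ` globally minimal with `3 ∤ Δ_min`: `3 ∣ #Ṽ(𝔽₃) ⟺ 3 ∣ b₂(V_ℤ) − 1`** (the tree's
`reductionPointCount V 3` is the point count of `integralModelInt V` modulo `3`). Silverman *AEC*
V.4.1(a), Ex. 5.7; Mazur 1972 §1. -/
theorem three_dvd_reductionPointCount_iff_dvd_b₂_sub_one (hΔ : ¬ (3 : ℤ) ∣ minimalDiscriminantInt V) :
    3 ∣ reductionPointCount V 3 ↔ (3 : ℤ) ∣ (integralModelInt V).b₂ - 1 :=
  three_dvd_natCard_point_map_iff_dvd_b₂_sub_one (integralModelInt V) hΔ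

/-- **`a₃(V) ≡ b₂(V_ℤ) (mod 3)`** for `V/ℚ` globally minimal with `3 ∤ Δ_min` (`a₃ = frobeniusTrace V 3
= 4 − #Ṽ(𝔽₃)`): the Hasse invariant at `3` is the residue of `b₂`. Silverman *AEC* V.4.1(a);
Husemöller Ch. 13 Prop. 3.6. -/
theorem intCast_frobeniusTrace_three_eq_b₂ (hΔ : ¬ (3 : ℤ) ∣ minimalDiscriminantInt V) :
    (V.frobeniusTrace 3 : ZMod 3) = ((integralModelInt V).b₂ : ZMod 3) := by
  rw [← intCast_trace_map_zmod_three_eq_b₂ (integralModelInt V) hΔ, frobeniusTrace,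
    reductionPointCount]
  push_cast
  ring

/-- **`V/ℚ` globally minimal with `3 ∤ Δ_min`: `3 ∣ a₃(V) − 1 ⟺ 3 ∣ b₂(V_ℤ) − 1`** — `V` is
ANOMALOUS at `3` (`a₃ ≡ 1 (mod 3)`, Mazur) iff `b₂ ≡ 1 (mod 3)`. Silverman *AEC* V.4.1(a), Ex. 5.7;
Mazur 1972 §1. -/
theorem three_dvd_frobeniusTrace_sub_one_iff_dvd_b₂_sub_one
    (hΔ : ¬ (3 : ℤ) ∣ minimalDiscriminantInt V) :
    (3 : ℤ) ∣ V.frobeniusTrace 3 - 1 ↔ (3 : ℤ) ∣ (integralModelInt V).b₂ - 1 := by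
  haveI : Fact (Nat.Prime 3) := ⟨Nat.prime_three⟩
  have h := intCast_frobeniusTrace_three_eq_b₂ V hΔ
  have e : ∀ m : ℤ, (3 : ℤ) ∣ m - 1 ↔ ((m : ZMod 3) = 1) := by
    intro m
    have hm := (ZMod.intCast_zmod_eq_zero_iff_dvd (m - 1) 3).symm
    push_cast at hm
    rwa [sub_eq_zero] at hm
  rw [e, e, h]

end IntModel

end DeuringThree

end Summit.BirchSwinnertonDyer.Rank1Residual.Additive

end
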